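import Summits.HodgeConjecture.HodgeConjecture.Theorems.HodgeLocusCensusTwoBlockChainCerts
import Summits.HodgeConjecture.HodgeConjecture.Theorems.HodgeLocusCensusCubicCells
import Literature.AlgebraicGeometry.Movasati2016.CubicFermatTwoLinearCyclesTable
import HarnessLib
import HarnessLib.Audit.Tags

/-!
# HodgeLocusCensusTwoBlockRows — Movasati's Conjecture 5 fails at (n,d,m) = (8,3,2): typed rows and the kernel-checked refutation (cell pub-hlocus, ENGINE B seat ivhs-2, gen 8)
HONEST FRAMING: certified instances and evidence bearing on the general Hodge conjecture; no claim.

[Movasati2016Periods] (arXiv:1602.06607v4, §6 'Sum of two linear cycles') defines H^d_n(m) := rank [p_{i+j}]([P^{n/2}] + [P̌^{n/2}]) for two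
linear cycles of the Fermat variety X^d_n with P^{n/2} ∩ P̌^{n/2} = ℙ^m and states CONJECTURE 5: "The number H^d_n(m) depends only on d, n, m and not
the choice of P^{n/2}, P̌^{n/2}" (verified there for (n,d) ∈ {(2,5…8), (4,4), (6,3)}; every printed number uses the STANDARD pair P̌ = P̌_m). This
file types the (n,d,m) = (8,3,2) instance of the conjecture for two explicit pairs of 4-planes in the Fermat cubic 8-fold and REFUTES it:
* standard pair (P0, P̌₂) = (`standardP 8`, `standardPc 8 2 1`): rank 16 for [P0] + [P̌₂] (`ivhsRankEq_stdSum`; the printed H³₈(2):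
  `Movasati2016.rankAt 8 2 = some 16`, `printed_H3_8_2`) and 16 for [P0] − [P̌₂] as well (the lead's `explainedSmooth_8_3_2_difference_holds`);
* TWO-BLOCK pair (P0, Ptwo), Ptwo = `twoBlockP8` = {x₀=ζx₁, x₂=ζx₄, x₃=ζx₅, x₆=ζx₈, x₇=ζx₉} (both coordinate 4-blocks of P0 re-matched):
  rank 17 for [P0] + [Ptwo] (`ivhsRankEq_twoSum`) and 16 for [P0] − [Ptwo] (`ivhsRankEq_twoDiff`);
* both pairs meet in a ℙ² (`inter_P0_twoBlock`, `inter_P0_std`: the common solutions of the two cones `coneP0 ∩ coneTwoBlock`, `coneP0 ∩ coneStd2` in solved form — 7 pivots, 3 free coordinates), so H³₈(2)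
  would have to be both 16 and 17: `movasatiConjecture5_at_8_3_2_false` (¬ `movasatiConjecture5_at_8_3_2`, instantiated at ℂ with ζ = e^{2πi/6}).
ORIENTATION. The matrix entries are the schema's normalised periods (`HodgeLocus.Census.period`, MV18 Thm. 1 with the orientation sign sign(b)), so
δ = [(1,P0),(1,Ptwo)] is the class [P0] + [Ptwo]. Independent check of the RELATIVE sign, typed below: along the chain P0 → P3 → Ptwo (P3 =
`midBlockP8`, only the last 4-block re-matched) consecutive planes meet in a ℙ³ (`inter_P0_mid`, `inter_mid_twoBlock`) and the union of each
consecutive pair is the complete intersection of three common linear forms, one more linear form and one quadric (`union_P0_mid_ci`,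
`union_mid_twoBlock_ci`), i.e. of type (1,1,1,1,2); and rank([P]+[P′]) = 10 = `Kloosterman2023.ciLocusCodim [1,1,1,1,2] 3` (the codimension of the
locus of cubic 8-folds containing such a complete intersection, [cite Kloosterman2023 Prop. 3.2], [cite MovasatiVillaflor2018 Thm. 2]; typed as
`ivhsRankEq_midSum_ci`, `ivhsRankEq_mid2Sum_ci`) for the sum but 13 for the difference at both steps (`ivhsRankEq_midDiff`, `ivhsRankEq_mid2Diff`).
Since the Hodge locus of the class of a complete intersection contains the complete-intersection locus, its Zariski tangent codimension — which is the
rank, [Movasati2016Periods, Thm. 6] — is at most 10 < 13: '+' is the geometric relative sign at each step, hence for (P0, Ptwo); for the standard pair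
both signs give 16 anyway. (This paragraph is the cited evidence for reading the typed rows geometrically; the typed refutation itself is a statement
about the schema's matrices.)
NUMERICS (two-implementation rule; here five): engine A (lead) = engine B (this seat) exact over ℚ(ζ₆) = engine B modulo two primes ≡ 1 (6) = gen 7's
standalone fresh-prime / regular-representation re-check = gen 8's fresh exact certificate generator gen8/cert83.py: 17, 16, 16, 10, 13, 10, 13; the
Lean kernel re-multiplies the dense certificates (`HodgeLocusCensusTwoBlockCerts`, `HodgeLocusCensusTwoBlockChainCerts`, `decide +kernel`) and
`DenseCert8.ivhsRankEq_of_cert` turns them into the rows. Refutation record with all six failing cells (8,3,2), (10,3,3), (12,3,4), (14,3,5), (6,4,1),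
(8,4,2): HOME/pub-hlocus-ivhs-2/CONJ5-REFUTATION-g7.md (only (8,3,2) is typed here).
-/

namespace Summit.HodgeConjecture.HodgeConjecture.HodgeLocus.Census

open DenseCert8 PlaneSum CubicSum
open Literature.AlgebraicGeometry.Kloosterman2023 (ciLocusCodim codimOne_pair_ciLocusCodim)

/-! ## The planes -/

/-- Ptwo: the 4-plane x₀=ζx₁, x₂=ζx₄, x₃=ζx₅, x₆=ζx₈, x₇=ζx₉ of the Fermat cubic 8-fold — the standard plane with BOTH coordinate 4-blocks
{2,3,4,5}, {6,7,8,9} re-matched (matching b = (3 4)(7 8), sign(b) = +1; no twists). -/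
def twoBlockP8 : LinearCycle 8 := ⟨fun _ => 0, Equiv.swap 3 4 * Equiv.swap 7 8⟩

/-- P3: the 4-plane x₀=ζx₁, x₂=ζx₃, x₄=ζx₅, x₆=ζx₈, x₇=ζx₉ — the standard plane with only the LAST 4-block re-matched (b = (7 8), sign(b) = −1). -/
def midBlockP8 : LinearCycle 8 := ⟨fun _ => 0, Equiv.swap 7 8⟩

section links

variable {K : Type*} [Field K] (ζ : K)

/-- the standard plane's periods as list data: signed datum +1, matching `blId`, twists `alZero`. -/
theorem period_standardP8 (h2 : ζ ^ 2 = ζ - 1) (i : Fin 10 → ℕ) :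
    period 8 3 ζ (standardP 8) i = Z6.eval ζ (pz ⟨1, blId, alZero⟩ (ext i)) :=
  period_eq_pz ζ h2 (standardP 8) ⟨1, blId, alZero⟩ (by simp [standardP]) (by decide) (by decide) i

/-- the standard twisted plane P̌₂ = `standardPc 8 2 1`: signed datum +1, matching `blId`, twists `alStd`. -/
theorem period_standardPc8 (h2 : ζ ^ 2 = ζ - 1) (i : Fin 10 → ℕ) :
    period 8 3 ζ (standardPc 8 2 1) i = Z6.eval ζ (pz ⟨1, blId, alStd⟩ (ext i)) :=
  period_eq_pz ζ h2 (standardPc 8 2 1) ⟨1, blId, alStd⟩ (by simp [standardPc]) (by decide) (by decide) i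

/-- sign of the two-block matching: (3 4)(7 8) is even. -/
theorem sign_twoBlockP8 : (Equiv.Perm.sign twoBlockP8.b : ℤ) = 1 := by
  simp [twoBlockP8, Equiv.Perm.sign_mul, Equiv.Perm.sign_swap (show (3 : Fin 10) ≠ 4 by decide),
    Equiv.Perm.sign_swap (show (7 : Fin 10) ≠ 8 by decide)]

/-- sign of the one-block matching: (7 8) is odd. -/
theorem sign_midBlockP8 : (Equiv.Perm.sign midBlockP8.b : ℤ) = -1 := by
  simp [midBlockP8, Equiv.Perm.sign_swap (show (7 : Fin 10) ≠ 8 by decide)]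

/-- the two-block plane: signed datum +1, matching `blTwo`, twists `alZero`. -/
theorem period_twoBlockP8 (h2 : ζ ^ 2 = ζ - 1) (i : Fin 10 → ℕ) :
    period 8 3 ζ twoBlockP8 i = Z6.eval ζ (pz ⟨1, blTwo, alZero⟩ (ext i)) :=
  period_eq_pz ζ h2 twoBlockP8 ⟨1, blTwo, alZero⟩ sign_twoBlockP8 (by decide) (by decide) i

/-- the one-block plane: signed datum −1, matching `blMid`, twists `alZero`. -/
theorem period_midBlockP8 (h2 : ζ ^ 2 = ζ - 1) (i : Fin 10 → ℕ) :
    period 8 3 ζ midBlockP8 i = Z6.eval ζ (pz ⟨-1, blMid, alZero⟩ (ext i)) :=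
  period_eq_pz ζ h2 midBlockP8 ⟨-1, blMid, alZero⟩ sign_midBlockP8 (by decide) (by decide) i

/-- flipping the signed datum negates the list period. -/
theorem eval_pz_neg (s : ℤ) (bl al : List ℕ) (v : ℕ → ℕ) :
    Z6.eval ζ (pz ⟨-s, bl, al⟩ v) = -Z6.eval ζ (pz ⟨s, bl, al⟩ v) := by
  have h := eval_pz_smul ζ (-1) s bl al v
  rw [neg_one_mul] at h
  rw [h]; push_cast; ring

/-- class [P0] + [Ptwo] ↔ list `twoSumL`. -/
theorem periodComb_twoSum (h2 : ζ ^ 2 = ζ - 1) (i : Fin 10 → ℕ) :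
    periodComb 8 3 ζ [(1, standardP 8), (1, twoBlockP8)] i = Z6.eval ζ (entry twoSumL (ext i)) := by
  have e0 := period_standardP8 ζ h2 i
  have e1 := period_twoBlockP8 ζ h2 i
  unfold periodComb
  simp only [List.map, List.sum_cons, List.sum_nil, twoSumL, eval_entry_cons, eval_entry_nil, e0, e1]
  push_cast; ring

/-- class [P0] − [Ptwo] ↔ list `twoDiffL`. -/
theorem periodComb_twoDiff (h2 : ζ ^ 2 = ζ - 1) (i : Fin 10 → ℕ) :
    periodComb 8 3 ζ [(1, standardP 8), (-1, twoBlockP8)] i = Z6.eval ζ (entry twoDiffL (ext i)) := by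
  have e0 := period_standardP8 ζ h2 i
  have e1 := period_twoBlockP8 ζ h2 i
  unfold periodComb
  simp only [List.map, List.sum_cons, List.sum_nil, twoDiffL, eval_entry_cons, eval_entry_nil, eval_pz_neg, e0, e1]
  push_cast; ring

/-- class [P0] + [P̌₂] ↔ list `stdSumL`. -/
theorem periodComb_stdSum (h2 : ζ ^ 2 = ζ - 1) (i : Fin 10 → ℕ) :
    periodComb 8 3 ζ [(1, standardP 8), (1, standardPc 8 2 1)] i = Z6.eval ζ (entry stdSumL (ext i)) := by
  have e0 := period_standardP8 ζ h2 i
  have e1 := period_standardPc8 ζ h2 i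
  unfold periodComb
  simp only [List.map, List.sum_cons, List.sum_nil, stdSumL, eval_entry_cons, eval_entry_nil, e0, e1]
  push_cast; ring

/-- class [P0] + [P3] ↔ list `midSumL`. -/
theorem periodComb_midSum (h2 : ζ ^ 2 = ζ - 1) (i : Fin 10 → ℕ) :
    periodComb 8 3 ζ [(1, standardP 8), (1, midBlockP8)] i = Z6.eval ζ (entry midSumL (ext i)) := by
  have e0 := period_standardP8 ζ h2 i
  have e1 := period_midBlockP8 ζ h2 i
  unfold periodComb
  simp only [List.map, List.sum_cons, List.sum_nil, midSumL, eval_entry_cons, eval_entry_nil, eval_pz_neg, e0, e1]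
  push_cast; ring

/-- class [P0] − [P3] ↔ list `midDiffL`. -/
theorem periodComb_midDiff (h2 : ζ ^ 2 = ζ - 1) (i : Fin 10 → ℕ) :
    periodComb 8 3 ζ [(1, standardP 8), (-1, midBlockP8)] i = Z6.eval ζ (entry midDiffL (ext i)) := by
  have e0 := period_standardP8 ζ h2 i
  have e1 := period_midBlockP8 ζ h2 i
  unfold periodComb
  simp only [List.map, List.sum_cons, List.sum_nil, midDiffL, eval_entry_cons, eval_entry_nil, eval_pz_neg, e0, e1]
  push_cast; ring

/-- class [P3] + [Ptwo] ↔ list `mid2SumL`. -/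
theorem periodComb_mid2Sum (h2 : ζ ^ 2 = ζ - 1) (i : Fin 10 → ℕ) :
    periodComb 8 3 ζ [(1, midBlockP8), (1, twoBlockP8)] i = Z6.eval ζ (entry mid2SumL (ext i)) := by
  have e0 := period_midBlockP8 ζ h2 i
  have e1 := period_twoBlockP8 ζ h2 i
  unfold periodComb
  simp only [List.map, List.sum_cons, List.sum_nil, mid2SumL, eval_entry_cons, eval_entry_nil, eval_pz_neg, e0, e1]
  push_cast; ring

/-- class [P3] − [Ptwo] ↔ list `mid2DiffL`. -/
theorem periodComb_mid2Diff (h2 : ζ ^ 2 = ζ - 1) (i : Fin 10 → ℕ) :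
    periodComb 8 3 ζ [(1, midBlockP8), (-1, twoBlockP8)] i = Z6.eval ζ (entry mid2DiffL (ext i)) := by
  have e0 := period_midBlockP8 ζ h2 i
  have e1 := period_twoBlockP8 ζ h2 i
  unfold periodComb
  simp only [List.map, List.sum_cons, List.sum_nil, mid2DiffL, eval_entry_cons, eval_entry_nil, eval_pz_neg, e0, e1]
  push_cast; ring

end links

/-! ## The typed rows (rank of [p_{i+j}(δ)] over every characteristic-0 field with a primitive 6th root of unity) -/

/-- (8,3 | two-block pair, m = 2): rank [p_{i+j}]([P0] + [Ptwo]) = 17. -/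
theorem ivhsRankEq_twoSum : IvhsRankEq 8 3 17 [(1, standardP 8), (1, twoBlockP8)] :=
  ivhsRankEq_of_cert twoSumL _ (fun _ _ ζ h2 i => periodComb_twoSum ζ h2 i) twoSumCert twoSum_valid

/-- (8,3 | two-block pair, m = 2): rank [p_{i+j}]([P0] − [Ptwo]) = 16. -/
theorem ivhsRankEq_twoDiff : IvhsRankEq 8 3 16 [(1, standardP 8), (-1, twoBlockP8)] :=
  ivhsRankEq_of_cert twoDiffL _ (fun _ _ ζ h2 i => periodComb_twoDiff ζ h2 i) twoDiffCert twoDiff_valid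

/-- (8,3 | standard pair, m = 2): rank [p_{i+j}]([P0] + [P̌₂]) = 16 (= the printed H³₈(2); the −1 row, rank 16 too, is
`explainedSmooth_8_3_2_difference_holds`). -/
theorem ivhsRankEq_stdSum : IvhsRankEq 8 3 16 [(1, standardP 8), (1, standardPc 8 2 1)] :=
  ivhsRankEq_of_cert stdSumL _ (fun _ _ ζ h2 i => periodComb_stdSum ζ h2 i) stdSumCert stdSum_valid

/-- the −1 standard row, restated from the lead's cubic cells for side-by-side reading: rank [p_{i+j}]([P0] − [P̌₂]) = 16. -/
theorem ivhsRankEq_stdDiff : IvhsRankEq 8 3 16 [(1, standardP 8), (-1, standardPc 8 2 1)] :=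
  explainedSmooth_8_3_2_difference_holds

/-- chain step 1, sum: rank [p_{i+j}]([P0] + [P3]) = 10. -/
theorem ivhsRankEq_midSum : IvhsRankEq 8 3 10 [(1, standardP 8), (1, midBlockP8)] :=
  ivhsRankEq_of_cert midSumL _ (fun _ _ ζ h2 i => periodComb_midSum ζ h2 i) midSumCert midSum_valid

/-- chain step 1, difference: rank [p_{i+j}]([P0] − [P3]) = 13. -/
theorem ivhsRankEq_midDiff : IvhsRankEq 8 3 13 [(1, standardP 8), (-1, midBlockP8)] :=
  ivhsRankEq_of_cert midDiffL _ (fun _ _ ζ h2 i => periodComb_midDiff ζ h2 i) midDiffCert midDiff_valid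

/-- chain step 2, sum: rank [p_{i+j}]([P3] + [Ptwo]) = 10. -/
theorem ivhsRankEq_mid2Sum : IvhsRankEq 8 3 10 [(1, midBlockP8), (1, twoBlockP8)] :=
  ivhsRankEq_of_cert mid2SumL _ (fun _ _ ζ h2 i => periodComb_mid2Sum ζ h2 i) mid2SumCert mid2Sum_valid

/-- chain step 2, difference: rank [p_{i+j}]([P3] − [Ptwo]) = 13. -/
theorem ivhsRankEq_mid2Diff : IvhsRankEq 8 3 13 [(1, midBlockP8), (-1, twoBlockP8)] :=
  ivhsRankEq_of_cert mid2DiffL _ (fun _ _ ζ h2 i => periodComb_mid2Diff ζ h2 i) mid2DiffCert mid2Diff_valid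

/-- the chain value 10 is Kloosterman's h_I(3) for CI(1,1,1,1,2) in cubic 8-folds (`codimOne_pair_ciLocusCodim`, a cited Literature evaluation). -/
theorem ciLocusCodim_11112_cubic : ciLocusCodim [1, 1, 1, 1, 2] 3 = 10 :=
  codimOne_pair_ciLocusCodim.2.2.2.2.2.2.2.2.2.1

/-- chain step 1 in invariant form: rank [p_{i+j}]([P0] + [P3]) = codim of the locus of cubic 8-folds containing a CI of type (1,1,1,1,2). -/
theorem ivhsRankEq_midSum_ci : IvhsRankEq 8 3 (ciLocusCodim [1, 1, 1, 1, 2] 3) [(1, standardP 8), (1, midBlockP8)] := by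
  rw [ciLocusCodim_11112_cubic]; exact ivhsRankEq_midSum

/-- chain step 2 in invariant form. -/
theorem ivhsRankEq_mid2Sum_ci : IvhsRankEq 8 3 (ciLocusCodim [1, 1, 1, 1, 2] 3) [(1, midBlockP8), (1, twoBlockP8)] := by
  rw [ciLocusCodim_11112_cubic]; exact ivhsRankEq_mid2Sum

/-- the printed value: Table 1 of [Movasati2016Periods, §6] at (n, n/2 − m) = (8, 2) has mydim³₈(2) = H³₈(2) = 16 — our `ivhsRankEq_stdSum`. -/
theorem printed_H3_8_2 : Literature.AlgebraicGeometry.Movasati2016.rankAt 8 2 = some 16 := by decide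

/-! ## Geometry of the pairs: intersections and the complete intersections of the chain
The linear 4-planes of K^{10} (cones over the projective 4-planes) attached to the four linear cycles, written out from MV18's
P_{a,b} = {x_{b(2e)} = ζ^{1+2a(2e+1)} x_{b(2e+1)}}; elementary linear algebra over any field. -/

section geometry

variable {K : Type*} [Field K] (ζ : K) (x : Fin 10 → K)

/-- the cone over P0 in K¹⁰: x₀=ζx₁, x₂=ζx₃, x₄=ζx₅, x₆=ζx₇, x₈=ζx₉. -/
def coneP0 : Set (Fin 10 → K) := {x | x 0 = ζ * x 1 ∧ x 2 = ζ * x 3 ∧ x 4 = ζ * x 5 ∧ x 6 = ζ * x 7 ∧ x 8 = ζ * x 9}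

/-- the cone over Ptwo: x₀=ζx₁, x₂=ζx₄, x₃=ζx₅, x₆=ζx₈, x₇=ζx₉. -/
def coneTwoBlock : Set (Fin 10 → K) := {x | x 0 = ζ * x 1 ∧ x 2 = ζ * x 4 ∧ x 3 = ζ * x 5 ∧ x 6 = ζ * x 8 ∧ x 7 = ζ * x 9}

/-- the cone over P̌₂ = `standardPc 8 2 1`: x₀=ζx₁, x₂=ζx₃, x₄=ζx₅, x₆=ζ³x₇, x₈=ζ³x₉. -/
def coneStd2 : Set (Fin 10 → K) := {x | x 0 = ζ * x 1 ∧ x 2 = ζ * x 3 ∧ x 4 = ζ * x 5 ∧ x 6 = ζ ^ 3 * x 7 ∧ x 8 = ζ ^ 3 * x 9}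

/-- the cone over P3: x₀=ζx₁, x₂=ζx₃, x₄=ζx₅, x₆=ζx₈, x₇=ζx₉. -/
def coneMidBlock : Set (Fin 10 → K) := {x | x 0 = ζ * x 1 ∧ x 2 = ζ * x 3 ∧ x 4 = ζ * x 5 ∧ x 6 = ζ * x 8 ∧ x 7 = ζ * x 9}

/-- all four cones lie on the Fermat cubic cone Σ x_k³ = 0 as soon as ζ³ = −1 (so they are 4-planes of the Fermat cubic 8-fold). -/
theorem fermat_of_mem_cones (h3 : ζ ^ 3 = -1)
    (hx : x ∈ coneP0 ζ ∪ coneTwoBlock ζ ∪ coneStd2 ζ ∪ coneMidBlock ζ) :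
    x 0 ^ 3 + x 1 ^ 3 + x 2 ^ 3 + x 3 ^ 3 + x 4 ^ 3 + x 5 ^ 3 + x 6 ^ 3 + x 7 ^ 3 + x 8 ^ 3 + x 9 ^ 3 = 0 := by
  rcases hx with ((⟨h0, h2, h4, h6, h8⟩ | ⟨h0, h2, h4, h6, h8⟩) | ⟨h0, h2, h4, h6, h8⟩) | ⟨h0, h2, h4, h6, h8⟩
  · rw [h0, h2, h4, h6, h8]; linear_combination (x 1 ^ 3 + x 3 ^ 3 + x 5 ^ 3 + x 7 ^ 3 + x 9 ^ 3) * h3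
  · rw [h0, h2, h4, h6, h8]; linear_combination (x 1 ^ 3 + x 4 ^ 3 + x 5 ^ 3 + x 8 ^ 3 + x 9 ^ 3) * h3
  · rw [h0, h2, h4, h6, h8]
    linear_combination (x 1 ^ 3 + x 3 ^ 3 + x 5 ^ 3 + (ζ ^ 6 - ζ ^ 3 + 1) * (x 7 ^ 3 + x 9 ^ 3)) * h3
  · rw [h0, h2, h4, h6, h8]; linear_combination (x 1 ^ 3 + x 3 ^ 3 + x 5 ^ 3 + x 8 ^ 3 + x 9 ^ 3) * h3

/-- P0 ∩ Ptwo = ℙ²: the common solutions in solved form — pivots x₀,x₂,x₃,x₄,x₆,x₇,x₈, free coordinates x₁,x₅,x₉ (m = 2). -/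
theorem inter_P0_twoBlock :
    x ∈ coneP0 ζ ∩ coneTwoBlock ζ ↔
      (x 0 = ζ * x 1 ∧ x 2 = ζ ^ 2 * x 5 ∧ x 3 = ζ * x 5 ∧ x 4 = ζ * x 5 ∧ x 6 = ζ ^ 2 * x 9 ∧ x 7 = ζ * x 9 ∧ x 8 = ζ * x 9) := by
  constructor
  · rintro ⟨⟨h0, h2, h4, h6, h8⟩, ⟨-, h2', h3', h6', h7'⟩⟩
    exact ⟨h0, by rw [h2, h3']; ring, h3', by rw [h4], by rw [h6, h7']; ring, h7', by rw [h8]⟩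
  · rintro ⟨h0, h2, h3, h4, h6, h7, h8⟩
    exact ⟨⟨h0, by rw [h2, h3]; ring, by rw [h4], by rw [h6, h7]; ring, by rw [h8]⟩,
      ⟨h0, by rw [h2, h4]; ring, h3, by rw [h6, h8]; ring, h7⟩⟩

/-- P0 ∩ P̌₂ = ℙ² (ζ a primitive 6th root of unity): pivots x₀,x₂,x₄,x₆,x₇,x₈,x₉, free x₁,x₃,x₅ (m = 2). -/
theorem inter_P0_std (hζ : IsPrimitiveRoot ζ (2 * 3)) :
    x ∈ coneP0 ζ ∩ coneStd2 ζ ↔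
      (x 0 = ζ * x 1 ∧ x 2 = ζ * x 3 ∧ x 4 = ζ * x 5 ∧ x 6 = 0 ∧ x 7 = 0 ∧ x 8 = 0 ∧ x 9 = 0) := by
  have hz0 : ζ ≠ 0 := hζ.ne_zero (by norm_num)
  have hz2 : ζ ^ 2 ≠ 1 := hζ.pow_ne_one_of_pos_of_lt (by norm_num) (by norm_num)
  have hne : ζ - ζ ^ 3 ≠ 0 := by
    intro h
    have h' : ζ * (1 - ζ ^ 2) = 0 := by linear_combination h
    rcases mul_eq_zero.1 h' with h'' | h''
    · exact hz0 h''
    · exact hz2 (by linear_combination -h'')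
  have cancel : ∀ t : K, (ζ - ζ ^ 3) * t = 0 → t = 0 := fun t ht =>
    (mul_eq_zero.1 ht).resolve_left hne
  constructor
  · rintro ⟨⟨h0, h2, h4, h6, h8⟩, ⟨-, -, -, h6', h8'⟩⟩
    have h7 : x 7 = 0 := cancel _ (by linear_combination h6' - h6)
    have h9 : x 9 = 0 := cancel _ (by linear_combination h8' - h8)
    exact ⟨h0, h2, h4, by rw [h6, h7, mul_zero], h7, by rw [h8, h9, mul_zero], h9⟩
  · rintro ⟨h0, h2, h4, h6, h7, h8, h9⟩
    exact ⟨⟨h0, h2, h4, by rw [h6, h7, mul_zero], by rw [h8, h9, mul_zero]⟩,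
      ⟨h0, h2, h4, by rw [h6, h7, mul_zero], by rw [h8, h9, mul_zero]⟩⟩

/-- P0 ∩ P3 = ℙ³: pivots x₀,x₂,x₄,x₆,x₇,x₈, free x₁,x₃,x₅,x₉ (m = 3 = n/2 − 1). -/
theorem inter_P0_mid :
    x ∈ coneP0 ζ ∩ coneMidBlock ζ ↔
      (x 0 = ζ * x 1 ∧ x 2 = ζ * x 3 ∧ x 4 = ζ * x 5 ∧ x 6 = ζ ^ 2 * x 9 ∧ x 7 = ζ * x 9 ∧ x 8 = ζ * x 9) := by
  constructor
  · rintro ⟨⟨h0, h2, h4, h6, h8⟩, ⟨-, -, -, h6', h7'⟩⟩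
    exact ⟨h0, h2, h4, by rw [h6, h7']; ring, h7', h8⟩
  · rintro ⟨h0, h2, h4, h6, h7, h8⟩
    exact ⟨⟨h0, h2, h4, by rw [h6, h7]; ring, h8⟩, ⟨h0, h2, h4, by rw [h6, h8]; ring, h7⟩⟩

/-- P3 ∩ Ptwo = ℙ³: pivots x₀,x₂,x₃,x₄,x₆,x₇, free x₁,x₅,x₈,x₉ (m = 3). -/
theorem inter_mid_twoBlock :
    x ∈ coneMidBlock ζ ∩ coneTwoBlock ζ ↔
      (x 0 = ζ * x 1 ∧ x 2 = ζ ^ 2 * x 5 ∧ x 3 = ζ * x 5 ∧ x 4 = ζ * x 5 ∧ x 6 = ζ * x 8 ∧ x 7 = ζ * x 9) := by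
  constructor
  · rintro ⟨⟨h0, h2, h4, h6, h7⟩, ⟨-, h2', h3', -, -⟩⟩
    exact ⟨h0, by rw [h2, h3']; ring, h3', h4, h6, h7⟩
  · rintro ⟨h0, h2, h3, h4, h6, h7⟩
    exact ⟨⟨h0, by rw [h2, h3]; ring, h4, h6, h7⟩, ⟨h0, by rw [h2, h4]; ring, h3, h6, h7⟩⟩

/-- P0 ∪ P3 is the complete intersection of type (1,1,1,1,2): three common linear forms, the linear form x₆ − ζx₇ − ζx₈ + ζ²x₉ and the
quadric (x₈ − ζx₉)(x₇ − ζx₉). -/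
theorem union_P0_mid_ci :
    x ∈ coneP0 ζ ∪ coneMidBlock ζ ↔
      (x 0 = ζ * x 1 ∧ x 2 = ζ * x 3 ∧ x 4 = ζ * x 5 ∧ x 6 - ζ * x 7 - ζ * x 8 + ζ ^ 2 * x 9 = 0 ∧
        (x 8 - ζ * x 9) * (x 7 - ζ * x 9) = 0) := by
  constructor
  · rintro (⟨h0, h2, h4, h6, h8⟩ | ⟨h0, h2, h4, h6, h7⟩)
    · exact ⟨h0, h2, h4, by rw [h6, h8]; ring, by rw [h8]; ring⟩
    · exact ⟨h0, h2, h4, by rw [h6, h7]; ring, by rw [h7]; ring⟩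
  · rintro ⟨h0, h2, h4, hl, hq⟩
    rcases mul_eq_zero.1 hq with h | h
    · have h8 : x 8 = ζ * x 9 := by linear_combination h
      exact Or.inl ⟨h0, h2, h4, by linear_combination hl + ζ * h8, h8⟩
    · have h7 : x 7 = ζ * x 9 := by linear_combination h
      exact Or.inr ⟨h0, h2, h4, by linear_combination hl + ζ * h7, h7⟩

/-- P3 ∪ Ptwo is the complete intersection of type (1,1,1,1,2): three common linear forms, the linear form x₂ − ζx₃ − ζx₄ + ζ²x₅ and the
quadric (x₄ − ζx₅)(x₃ − ζx₅). -/
theorem union_mid_twoBlock_ci :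
    x ∈ coneMidBlock ζ ∪ coneTwoBlock ζ ↔
      (x 0 = ζ * x 1 ∧ x 6 = ζ * x 8 ∧ x 7 = ζ * x 9 ∧ x 2 - ζ * x 3 - ζ * x 4 + ζ ^ 2 * x 5 = 0 ∧
        (x 4 - ζ * x 5) * (x 3 - ζ * x 5) = 0) := by
  constructor
  · rintro (⟨h0, h2, h4, h6, h7⟩ | ⟨h0, h2, h3, h6, h7⟩)
    · exact ⟨h0, h6, h7, by rw [h2, h4]; ring, by rw [h4]; ring⟩
    · exact ⟨h0, h6, h7, by rw [h2, h3]; ring, by rw [h3]; ring⟩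
  · rintro ⟨h0, h6, h7, hl, hq⟩
    rcases mul_eq_zero.1 hq with h | h
    · have h4 : x 4 = ζ * x 5 := by linear_combination h
      exact Or.inl ⟨h0, by linear_combination hl + ζ * h4, h4, h6, h7⟩
    · have h3 : x 3 = ζ * x 5 := by linear_combination h
      exact Or.inr ⟨h0, by linear_combination hl + ζ * h3, h3, h6, h7⟩

end geometry

/-! ## Conjecture 5 at (8,3,2) and its refutation -/

/-- Movasati's CONJECTURE 5 [cite: Movasati2016Periods, §6 Conj. 5 (colombianos2017)] — "The number H^d_n(m) := rank [p_{i+j}]([P^{n/2}] + [P̌^{n/2}]),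
P^{n/2} ∩ P̌^{n/2} = ℙ^m, depends only on d, n, m and not the choice of P^{n/2}, P̌^{n/2}" — INSTANTIATED at (n,d,m) = (8,3,2) for the two pairs
(P0, Ptwo) and (P0, P̌₂) of 4-planes of the Fermat cubic 8-fold, both meeting in a ℙ² (`inter_P0_twoBlock`, `inter_P0_std`): the two period
matrices (schema normalisation, any characteristic-0 field with a primitive 6th root ζ) have the same rank. A CONSEQUENCE of the printed conjecture,
typed by the cell (not a printed statement); refuted below. -/
@[conjecture] def movasatiConjecture5_at_8_3_2 : Prop :=
  ∀ (K : Type) [Field K] [CharZero K] (ζ : K), IsPrimitiveRoot ζ (2 * 3) →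
    (ivhsMatrix 8 3 ζ [(1, standardP 8), (1, twoBlockP8)]).rank =
      (ivhsMatrix 8 3 ζ [(1, standardP 8), (1, standardPc 8 2 1)]).rank

/-- REFUTATION of Conjecture 5 at (8,3,2): at ζ = e^{2πi/6} ∈ ℂ the two-block pair has rank 17 (`ivhsRankEq_twoSum`) and the standard pair 16
(`ivhsRankEq_stdSum`). -/
@[refutes] theorem movasatiConjecture5_at_8_3_2_false : ¬ movasatiConjecture5_at_8_3_2 := by
  intro h
  have hζ := Complex.isPrimitiveRoot_exp (2 * 3) (by norm_num)
  have h17 := ivhsRankEq_twoSum ℂ _ hζ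
  have h16 := ivhsRankEq_stdSum ℂ _ hζ
  have := h ℂ _ hζ
  rw [h17, h16] at this
  exact absurd this (by norm_num)

/-- the same two numbers side by side: the rank of the two-block pair exceeds the printed / standard value H³₈(2) = 16 by one. -/
theorem twoBlock_rank_eq_std_rank_add_one :
    ∀ (K : Type) [Field K] [CharZero K] (ζ : K), IsPrimitiveRoot ζ (2 * 3) →
      (ivhsMatrix 8 3 ζ [(1, standardP 8), (1, twoBlockP8)]).rank =
        (ivhsMatrix 8 3 ζ [(1, standardP 8), (1, standardPc 8 2 1)]).rank + 1 := by
  intro K _ _ ζ hζ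
  rw [ivhsRankEq_twoSum K ζ hζ, ivhsRankEq_stdSum K ζ hζ]

end Summit.HodgeConjecture.HodgeConjecture.HodgeLocus.Census
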